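import Literature.NumberTheory.Transcendental.RoySmallValueMainD
import Literature.NumberTheory.Transcendental.RoySmallValueEndgame
import Literature.NumberTheory.Transcendental.RoySmallValueAsymptotics
import Mathlib.Analysis.Complex.ExponentialBounds
import HarnessLib

/-!
# Roy's small value estimate for `𝔾ₐ × 𝔾ₘ` — proof of Theorem 1.1, part E: the side conditions hold for `D ≫ 0`

Topic `Literature/NumberTheory/Transcendental`. Part of the formalisation of the proof of Roy 2013,
Theorem 1.1 (named fact `roy2013_thm_1_1`, `RoySmallValueEstimates.lean`). Source: D. Roy,
*A small value estimate for `𝔾ₐ × 𝔾ₘ`*, Mathematika 59 (2013) 333–363 = arXiv:1301.0663, §7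
(pp. 18–19 of the arXiv text):

> [...] assuming that `D` is sufficiently large, the hypotheses of Proposition 6.2 are all
> fulfilled (because `1 ≤ τ < min{2, β}` and `τ + ν > 2 + β`) [...] if `D` is large enough (because
> `β > τ ≥ 1`) [...] provided that `D` is large enough [...]

This file discharges the numerical side conditions `Setting.Good E` of parts B–D for all large
`E` (`eventually_good`): each is reduced, by crude explicit bounds on the auxiliary parameters
(`L_E ≪ E^{τ/2}`, `k ≪ log E`, `N_E ≪ E²`, the error term `E₂ ≪ E^τ log² E`), to finitely many
comparisons `C E^a (log E)^n ≤ E^b` with `a < b` (`RoySmallValueAsymptotics`), the exponent gaps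
being exactly the hypotheses `1 ≤ τ < 2`, `τ < β`, `ν > 2 + β − τ` (`δ > 0`, `ν > 2`) of the
theorem. Everything is proved; no definitions, no named facts.

The named fact itself is discharged, under its fully qualified name
`Literature.NumberTheory.Transcendental.roy2013_thm_1_1_holds`, in `RoySmallValueMain.lean`
(parallel seat, via `LevelPkg.step2_level` / `ZeroConfigK.step45_combined`). The present chain
(`RoySmallValueMainA`–`MainD` and this file: `Setting`, `Setting.Good`, `Setting.main_step`) is an
independent second assembly of §7; it ends with `Setting.isAlgebraic` (the setting of a
counterexample is contradictory) and the closing `example : roy2013_thm_1_1` below, which is the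
ten-line passage from the fact's hypotheses to a `Setting`.

## References

* [Roy2013] D. Roy, *A small value estimate for 𝔾ₐ × 𝔾ₘ*, Mathematika 59 (2013), 333–363
  (arXiv:1301.0663), §7.
-/

noncomputable section

open MvPolynomial Finset Filter Real

namespace Literature.NumberTheory.Transcendental

namespace Roy2013

open Nesterenko

/-! ### Numerical constants -/

/-- `log (N!) ≤ N log N` (a private copy of a folklore bound; cf. the tree's
`Literature.Barriers.MatrixMultiplication.log_factorial_le_mul_log`). [folklore] -/
private theorem log_factorial_le (N : ℕ) : Real.log (N.factorial) ≤ N * Real.log N := by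
  rcases Nat.eq_zero_or_pos N with rfl | hN
  · simp
  · have h1 : ((N.factorial : ℕ) : ℝ) ≤ ((N ^ N : ℕ) : ℝ) := by exact_mod_cast Nat.factorial_le_pow N
    calc Real.log (N.factorial) ≤ Real.log ((N ^ N : ℕ) : ℝ) :=
          Real.log_le_log (by exact_mod_cast Nat.factorial_pos N) h1
      _ = N * Real.log N := by push_cast; rw [Real.log_pow]

/-- `1/3 < log(3/2)`. [folklore] -/
theorem third_lt_log_three_halves : (1 : ℝ) / 3 < Real.log (3 / 2) := by
  rw [Real.lt_log_iff_exp_lt (by norm_num)]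
  have h1 : Real.exp (1 / 3) ^ 3 = Real.exp 1 := by
    rw [← Real.exp_nat_mul]; norm_num
  have h2 : Real.exp 1 < (3 / 2 : ℝ) ^ 3 := by
    have := Real.exp_one_lt_d9; norm_num at this ⊢; linarith
  by_contra h
  push Not at h
  have h3 : (3 / 2 : ℝ) ^ 3 ≤ Real.exp (1 / 3) ^ 3 := pow_le_pow_left₀ (by norm_num) h 3
  rw [h1] at h3
  linarith

/-- `2/3 < log 2`. [folklore] -/
theorem two_thirds_lt_log_two : (2 : ℝ) / 3 < Real.log 2 := by
  have := Real.log_two_gt_d9; norm_num at this ⊢; linarith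

/-! ### The error term `E₂` of Step 2 -/

/-- The inner constant `c₈ = 3(1+|ξ|+|η|⁻¹) c₂ ≥ 3`. [folklore] -/
theorem three_le_c8 (ξ η : ℂ) : (3 : ℝ) ≤ 3 * (1 + ‖ξ‖ + ‖η‖⁻¹) * max 1 (max ‖ξ‖ ‖η‖) := by
  have h1 : (1 : ℝ) ≤ max 1 (max ‖ξ‖ ‖η‖) := le_max_left _ _
  have h2 : (1 : ℝ) ≤ 1 + ‖ξ‖ + ‖η‖⁻¹ := by
    have : (0 : ℝ) ≤ ‖ξ‖ := norm_nonneg _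
    have : (0 : ℝ) ≤ ‖η‖⁻¹ := inv_nonneg.mpr (norm_nonneg _)
    linarith
  nlinarith

/-- `log C45base = log 3 + T log c₈ + T (log 16 + 3 log T)`. [folklore] -/
theorem log_C45base {T : ℕ} (hT : 1 ≤ T) (ξ η : ℂ) :
    Real.log (C45base ξ η T) = Real.log 3 + T * Real.log (3 * (1 + ‖ξ‖ + ‖η‖⁻¹) * max 1 (max ‖ξ‖ ‖η‖)) +
      T * (Real.log 16 + 3 * Real.log T) := by
  have hc8 : (0 : ℝ) < 3 * (1 + ‖ξ‖ + ‖η‖⁻¹) * max 1 (max ‖ξ‖ ‖η‖) := by linarith [three_le_c8 ξ η]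
  have hT0 : (0 : ℝ) < T := by exact_mod_cast hT
  have h1 : (3 * (1 + ‖ξ‖ + ‖η‖⁻¹) * max 1 (max ‖ξ‖ ‖η‖)) ^ T ≠ 0 := pow_ne_zero _ hc8.ne'
  have h2 : (16 * (T : ℝ) ^ 3) ^ T ≠ 0 := pow_ne_zero _ (by positivity)
  rw [C45base, Real.log_mul (mul_ne_zero (by norm_num) h1) h2,
    Real.log_mul (show (3 : ℝ) ≠ 0 by norm_num) h1, Real.log_pow, Real.log_pow,
    Real.log_mul (show (16 : ℝ) ≠ 0 by norm_num) (show (T : ℝ) ^ 3 ≠ 0 by positivity), Real.log_pow]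
  push_cast; ring

/-- **The identity for `E₂`**: `errStep2` as an explicit linear expression in `k log C45base`,
`T` and constants. [folklore] -/
theorem errStep2_eq {T : ℕ} (hT : 1 ≤ T) (ξ η : ℂ) (k : ℕ) :
    errStep2 ξ η T k = T * Real.log 2 + k * Real.log (C45base ξ η T) +
      (T * Real.log (2 * roy_c2 ξ η) + Real.log (1 + roy_c2 ξ η * Real.exp (1 + roy_c2 ξ η)) +
        k * Real.log (C45base ξ η T)) +
      (Real.log 2 + (Real.log (roy_c2 ξ η) + roy_c2 ξ η + T * Real.log (2 * roy_c2 ξ η ^ 2))) +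
      Real.log 2 + T * Real.log (2 * roy_c2 ξ η) := by
  have hc := one_le_roy_c2 ξ η
  have hc0 : 0 < roy_c2 ξ η := by linarith
  have hbase : 0 < C45base ξ η T := lt_of_lt_of_le one_pos (one_le_C45base ξ η hT)
  have h1 : Real.log (C45i ξ η T k) = T * Real.log 2 + k * Real.log (C45base ξ η T) := by
    rw [C45i, Real.log_mul (by positivity) (by positivity), Real.log_pow, Real.log_pow]
  have h2 : Real.log (C45ii ξ η T k) = T * Real.log (2 * roy_c2 ξ η) +
      Real.log (1 + roy_c2 ξ η * Real.exp (1 + roy_c2 ξ η)) + k * Real.log (C45base ξ η T) := by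
    have hpos : 0 < 1 + roy_c2 ξ η * Real.exp (1 + roy_c2 ξ η) := by positivity
    rw [C45ii, Real.log_mul (by positivity) (by positivity), Real.log_mul (by positivity) hpos.ne',
      Real.log_pow, Real.log_pow]
  have h3 : Real.log (2 * C45iii ξ η T) = Real.log 2 + (Real.log (roy_c2 ξ η) + roy_c2 ξ η +
      T * Real.log (2 * roy_c2 ξ η ^ 2)) := by
    rw [C45iii, Real.log_mul (by norm_num) (by positivity), Real.log_mul (by positivity) (by positivity),
      Real.log_mul hc0.ne' (by positivity), Real.log_exp, Real.log_pow]
  rw [errStep2, h1, h2, h3]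

/-- **The bound for `E₂`** in terms of `T` and `k`:
`E₂ ≤ c_A + c_B T + 2k (2 + (log c₈ + 4) T + 3 T log T)`. [folklore] -/
theorem errStep2_le {T : ℕ} (hT : 1 ≤ T) (ξ η : ℂ) (k : ℕ) :
    errStep2 ξ η T k ≤
      (Real.log (1 + roy_c2 ξ η * Real.exp (1 + roy_c2 ξ η)) + 2 + Real.log (roy_c2 ξ η) + roy_c2 ξ η) +
      (1 + 2 * Real.log (2 * roy_c2 ξ η) + Real.log (2 * roy_c2 ξ η ^ 2)) * T +
      2 * k * (2 + (Real.log (3 * (1 + ‖ξ‖ + ‖η‖⁻¹) * max 1 (max ‖ξ‖ ‖η‖)) + 4) * T +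
        3 * T * Real.log T) := by
  have hc := one_le_roy_c2 ξ η
  have hT1 : (1 : ℝ) ≤ T := by exact_mod_cast hT
  have hk : (0 : ℝ) ≤ k := Nat.cast_nonneg _
  rw [errStep2_eq hT, log_C45base hT]
  have hl2 : Real.log 2 ≤ 1 := by linarith [Real.log_le_sub_one_of_pos two_pos]
  have hl3 : Real.log 3 ≤ 2 := by linarith [Real.log_le_sub_one_of_pos (by norm_num : (0:ℝ) < 3)]
  have hl16 : Real.log 16 ≤ 4 := by
    rw [show (16 : ℝ) = 2 ^ 4 by norm_num, Real.log_pow]; push_cast; linarith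
  have hlT : 0 ≤ Real.log T := Real.log_nonneg hT1
  have hc8 := three_le_c8 ξ η
  have hlc8 : 0 ≤ Real.log (3 * (1 + ‖ξ‖ + ‖η‖⁻¹) * max 1 (max ‖ξ‖ ‖η‖)) := Real.log_nonneg (by linarith)
  -- `LB ≤ 2 + (log c₈ + 4) T + 3 T log T`
  have hLB : Real.log 3 + T * Real.log (3 * (1 + ‖ξ‖ + ‖η‖⁻¹) * max 1 (max ‖ξ‖ ‖η‖)) +
      T * (Real.log 16 + 3 * Real.log T) ≤
      2 + (Real.log (3 * (1 + ‖ξ‖ + ‖η‖⁻¹) * max 1 (max ‖ξ‖ ‖η‖)) + 4) * T + 3 * T * Real.log T := by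
    nlinarith
  have hkLB := mul_le_mul_of_nonneg_left hLB hk
  nlinarith

namespace Setting

variable (S : Setting)

/-! ### Bounds on the auxiliary parameters -/

/-- `T_E ≤ E²` as reals, and `log T_E ≤ 2 log E` (`E ≥ 1`). [folklore] -/
theorem log_T_le {E : ℕ} (hE : 1 ≤ E) : Real.log (S.T E) ≤ 2 * Real.log E := by
  have hT : (1 : ℝ) ≤ S.T E := by exact_mod_cast le_trans hE (S.le_T E)
  have h1 : (S.T E : ℝ) ≤ (E : ℝ) ^ 2 := by exact_mod_cast S.T_le_sq E
  rw [show (2 : ℝ) * Real.log E = Real.log ((E : ℝ) ^ 2) by rw [Real.log_pow]; norm_num]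
  exact Real.log_le_log (by linarith) h1

/-- `2^{kexp E} ≤ 2E²` and `kexp E ≤ 1 + 3 log E` (`E ≥ 1`). [folklore] -/
theorem kexp_bounds {E : ℕ} (hE : 1 ≤ E) :
    ((2 : ℝ) ^ kexp E ≤ 2 * (E : ℝ) ^ 2) ∧ ((kexp E : ℝ) ≤ 1 + 3 * Real.log E) := by
  have hE0 : (0 : ℝ) < E := by exact_mod_cast hE
  have hE1 : (1 : ℝ) ≤ E := by exact_mod_cast hE
  have hlogE : 0 ≤ Real.log E := Real.log_nonneg hE1
  rcases Nat.eq_zero_or_pos (kexp E) with h0 | hpos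
  · rw [h0]; refine ⟨by norm_num; nlinarith, by simp; linarith⟩
  · -- minimality at `kexp E − 1`
    have hmin := Nat.find_min (⟨E ^ 2, (Nat.lt_two_pow_self).le⟩ : ∃ k, E ^ 2 ≤ 2 ^ k)
      (m := kexp E - 1) (by rw [kexp] at hpos ⊢; omega)
    rw [not_le] at hmin
    have h1 : (2 : ℝ) ^ (kexp E - 1) < (E : ℝ) ^ 2 := by exact_mod_cast hmin
    have h2 : (2 : ℝ) ^ kexp E = 2 * 2 ^ (kexp E - 1) := by
      rw [← pow_succ']; congr 1; omega
    refine ⟨by rw [h2]; linarith, ?_⟩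
    -- `(k−1) log 2 < 2 log E`
    have h3 : ((kexp E - 1 : ℕ) : ℝ) * Real.log 2 < 2 * Real.log E := by
      rw [← Real.log_pow, show (2 : ℝ) * Real.log E = Real.log ((E : ℝ) ^ 2) by
        rw [Real.log_pow]; norm_num]
      exact Real.log_lt_log (by positivity) h1
    have h4 : ((kexp E - 1 : ℕ) : ℝ) = kexp E - 1 := by
      rw [Nat.cast_sub (by omega)]; simp
    rw [h4] at h3
    have hl2 := two_thirds_lt_log_two
    nlinarith

/-- `k45 E ≤ 1 + 3 log E` (`E ≥ 1`). [folklore] -/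
theorem k45_le {E : ℕ} (hE : 1 ≤ E) : (S.k45 E : ℝ) ≤ 1 + 3 * Real.log E := by
  have hE1 : (1 : ℝ) ≤ E := by exact_mod_cast hE
  have hlogE : 0 ≤ Real.log E := Real.log_nonneg hE1
  rcases Nat.eq_zero_or_pos (S.k45 E) with h0 | hpos
  · rw [h0]; simp; linarith
  · have hmin := Nat.find_min (S.exists_k45 E) (m := S.k45 E - 1) (by rw [Setting.k45] at hpos ⊢; omega)
    rw [not_le] at hmin
    -- `3^{k−1} E < 2^{k−1} T ≤ 2^{k−1} E²`, so `(3/2)^{k−1} < E`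
    have h1 : (3 : ℝ) ^ (S.k45 E - 1) * E < 2 ^ (S.k45 E - 1) * S.T E := by exact_mod_cast hmin
    have hT : (S.T E : ℝ) ≤ (E : ℝ) ^ 2 := by exact_mod_cast S.T_le_sq E
    have hE0 : (0 : ℝ) < E := by linarith
    have h2 : (3 / 2 : ℝ) ^ (S.k45 E - 1) < E := by
      have h3 : (3 : ℝ) ^ (S.k45 E - 1) * E < (2 ^ (S.k45 E - 1) * E) * E := by
        calc (3 : ℝ) ^ (S.k45 E - 1) * E < 2 ^ (S.k45 E - 1) * S.T E := h1
          _ ≤ 2 ^ (S.k45 E - 1) * (E : ℝ) ^ 2 :=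
              mul_le_mul_of_nonneg_left hT (by positivity)
          _ = (2 ^ (S.k45 E - 1) * E) * E := by ring
      have h5 : (3 : ℝ) ^ (S.k45 E - 1) < 2 ^ (S.k45 E - 1) * E := lt_of_mul_lt_mul_right h3 hE0.le
      rw [div_pow, div_lt_iff₀ (by positivity)]
      linarith
    have h3 : ((S.k45 E - 1 : ℕ) : ℝ) * Real.log (3 / 2) < Real.log E := by
      rw [← Real.log_pow]
      exact Real.log_lt_log (by positivity) h2
    have h4 : ((S.k45 E - 1 : ℕ) : ℝ) = S.k45 E - 1 := by
      rw [Nat.cast_sub (by omega)]; simp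
    rw [h4] at h3
    have hl := third_lt_log_three_halves
    nlinarith

/-- `binom(L_E + 2, 2) ≤ 3 T_E` (`E ≥ 1`). [folklore] -/
theorem choose_L_le {E : ℕ} (hE : 1 ≤ E) : (S.L E + 2).choose 2 ≤ 3 * S.T E := by
  have hlt := S.choose_lt_T hE
  have hT : 1 ≤ S.T E := le_trans hE (S.le_T E)
  have h1 : (S.L E + 2).choose 2 = (S.L E + 1).choose 2 + (S.L E + 1) := by
    rw [Nat.choose_succ_succ, Nat.choose_one_right, add_comm]
  rcases Nat.eq_zero_or_pos (S.L E) with h0 | hpos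
  · rw [h0] at h1 ⊢; simp at h1 ⊢; omega
  · have h2 : S.L E ≤ (S.L E + 1).choose 2 := by
      rw [Nat.choose_two_right, Nat.add_sub_cancel, Nat.le_div_iff_mul_le two_pos]
      nlinarith
    omega

/-- `3(L_E + 1) ≤ E` once `36 E^τ ≤ E²` and `E ≥ 12`. [folklore] -/
theorem hL_of {E : ℕ} (hE : 12 ≤ E) (h : 36 * (E : ℝ) ^ S.τ ≤ (E : ℝ) ^ 2) : 3 * (S.L E + 1) ≤ E := by
  have hE1 : 1 ≤ E := le_trans (by norm_num) hE
  have hlt := S.choose_lt_T hE1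
  -- `L² < 2T ≤ 2E^τ`
  have h1 : (S.L E : ℝ) ^ 2 < 2 * (E : ℝ) ^ S.τ := by
    have h2 : S.L E * S.L E < 2 * S.T E := by
      rw [Nat.choose_two_right, Nat.add_sub_cancel] at hlt
      have : (S.L E + 1) * S.L E < S.T E * 2 := (Nat.div_lt_iff_lt_mul two_pos).mp hlt
      nlinarith
    have h3 : ((S.L E * S.L E : ℕ) : ℝ) < ((2 * S.T E : ℕ) : ℝ) := by exact_mod_cast h2
    push_cast at h3
    have h4 := S.T_le E
    nlinarith
  -- hence `(3L)² < 18 E^τ ≤ E²/2 ≤ (E − 3)²`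
  have hx : (12 : ℝ) ≤ E := by exact_mod_cast hE
  have h2 : ((3 * S.L E : ℕ) : ℝ) ^ 2 < ((E : ℝ) - 3) ^ 2 := by
    push_cast
    nlinarith
  have h3 : ((3 * S.L E : ℕ) : ℝ) < (E : ℝ) - 3 := by
    have hnn : (0 : ℝ) ≤ (E : ℝ) - 3 := by linarith
    exact lt_of_pow_lt_pow_left₀ 2 hnn h2
  have h4 : ((3 * S.L E : ℕ) : ℝ) + 3 < E := by linarith
  push_cast at h4
  have h6 : 3 * S.L E + 3 < E := by exact_mod_cast h4
  omega

/-! ### The side conditions, pointwise, from simple inequalities -/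

section pointwise

variable {E : ℕ}

/-- Common facts at `E ≥ 2`. [folklore] -/
theorem basics (hE : 2 ≤ E) :
    (2 : ℝ) ≤ E ∧ (0 : ℝ) < E ∧ 0 ≤ Real.log E ∧ (1 : ℝ) ≤ S.T E ∧ (S.T E : ℝ) ≤ (E : ℝ) ^ S.τ ∧
      (E : ℝ) ≤ (E : ℝ) ^ S.τ ∧ (E : ℝ) ^ S.τ ≤ 2 * S.T E := by
  have hx2 : (2 : ℝ) ≤ E := by exact_mod_cast hE
  have hx1 : (1 : ℝ) ≤ E := by linarith
  have hx0 : (0 : ℝ) < E := by linarith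
  have hE1 : 1 ≤ E := le_trans one_le_two hE
  have hT1 : (1 : ℝ) ≤ S.T E := by exact_mod_cast le_trans hE1 (S.le_T E)
  have hxτ : (E : ℝ) ≤ (E : ℝ) ^ S.τ := by
    calc (E : ℝ) = (E : ℝ) ^ (1 : ℝ) := (Real.rpow_one _).symm
      _ ≤ (E : ℝ) ^ S.τ := Real.rpow_le_rpow_of_exponent_le hx1 S.hτ1
  refine ⟨hx2, hx0, Real.log_nonneg hx1, hT1, S.T_le E, hxτ, ?_⟩
  rw [Setting.T]
  exact le_two_mul_floor (le_trans hx2 hxτ)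

/-- `x^{2T} ((E+1)² e^{x^β}) ≤ exp(2x^τ log x + 2x + x^β)`. [folklore] -/
theorem step1_norm_factor_le (hE : 2 ≤ E) :
    ((E : ℝ) ^ (2 * S.T E)) * (((E + 1) ^ 2 : ℕ) * Real.exp ((E : ℝ) ^ S.β)) ≤
      Real.exp (2 * (E : ℝ) ^ S.τ * Real.log E + 2 * E + (E : ℝ) ^ S.β) := by
  obtain ⟨hx2, hx0, hlog, hT1, hTle, hxτ, -⟩ := S.basics hE
  have h1 : (E : ℝ) ^ (2 * S.T E) ≤ Real.exp (2 * (E : ℝ) ^ S.τ * Real.log E) := by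
    rw [show (E : ℝ) ^ (2 * S.T E) = Real.exp ((2 * S.T E : ℕ) * Real.log E) by
      rw [Real.exp_nat_mul, Real.exp_log hx0]]
    refine Real.exp_le_exp.mpr ?_
    push_cast
    nlinarith
  have h2 : (((E + 1) ^ 2 : ℕ) : ℝ) ≤ Real.exp (2 * E) := by
    push_cast
    have h3 : (E : ℝ) + 1 ≤ Real.exp E := Real.add_one_le_exp _
    calc ((E : ℝ) + 1) ^ 2 ≤ Real.exp E ^ 2 := pow_le_pow_left₀ (by linarith) h3 2
      _ = Real.exp (2 * E) := by rw [← Real.exp_nat_mul]; norm_num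
  calc ((E : ℝ) ^ (2 * S.T E)) * (((E + 1) ^ 2 : ℕ) * Real.exp ((E : ℝ) ^ S.β))
      ≤ Real.exp (2 * (E : ℝ) ^ S.τ * Real.log E) * (Real.exp (2 * E) * Real.exp ((E : ℝ) ^ S.β)) :=
        mul_le_mul h1 (mul_le_mul_of_nonneg_right h2 (Real.exp_pos _).le) (by positivity) (Real.exp_pos _).le
    _ = Real.exp (2 * (E : ℝ) ^ S.τ * Real.log E + 2 * E + (E : ℝ) ^ S.β) := by
        rw [← Real.exp_add, ← Real.exp_add]; ring_nf

/-- **`hA1`** from `2x^τ log x + 2x ≤ x^β`. [cite: Roy2013, §7, Step 1] -/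
theorem hA1_of (hE : 2 ≤ E) (h : 2 * (E : ℝ) ^ S.τ * Real.log E + 2 * E ≤ (E : ℝ) ^ S.β) :
    ((E : ℝ) ^ (2 * S.T E)) * (((E + 1) ^ 2 : ℕ) * Real.exp ((E : ℝ) ^ S.β)) ≤ Real.exp (S.Y E) := by
  refine (S.step1_norm_factor_le hE).trans (Real.exp_le_exp.mpr ?_)
  rw [Setting.Y]; linarith

/-- **`hA3`** from `log x + 2x log x + 2x^τ log x + 2x ≤ x^β`. [cite: Roy2013, §7, Step 2] -/
theorem hA3_of (hE : 2 ≤ E)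
    (h : Real.log E + 2 * E * Real.log E + 2 * (E : ℝ) ^ S.τ * Real.log E + 2 * E ≤ (E : ℝ) ^ S.β) :
    (E : ℝ) * ((E : ℝ) ^ 2) ^ E * (((E : ℝ) ^ (2 * S.T E)) *
      (((E + 1) ^ 2 : ℕ) * Real.exp ((E : ℝ) ^ S.β))) ≤ Real.exp (S.Y E) := by
  obtain ⟨hx2, hx0, hlog, -, -, -, -⟩ := S.basics hE
  have h1 : (E : ℝ) * ((E : ℝ) ^ 2) ^ E = Real.exp (Real.log E + 2 * E * Real.log E) := by
    rw [Real.exp_add, Real.exp_log hx0, show 2 * (E : ℝ) * Real.log E = ((2 * E : ℕ) : ℝ) * Real.log E by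
      push_cast; ring, Real.exp_nat_mul, Real.exp_log hx0, pow_mul]
  rw [h1]
  calc Real.exp (Real.log E + 2 * E * Real.log E) * (((E : ℝ) ^ (2 * S.T E)) *
        (((E + 1) ^ 2 : ℕ) * Real.exp ((E : ℝ) ^ S.β)))
      ≤ Real.exp (Real.log E + 2 * E * Real.log E) *
          Real.exp (2 * (E : ℝ) ^ S.τ * Real.log E + 2 * E + (E : ℝ) ^ S.β) :=
        mul_le_mul_of_nonneg_left (S.step1_norm_factor_le hE) (Real.exp_pos _).le
    _ ≤ Real.exp (S.Y E) := by
        rw [← Real.exp_add, Setting.Y]; exact Real.exp_le_exp.mpr (by linarith)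

/-- `(2x+1)^{3T} M₁^E M₂^E e^{−x^ν} ≤ exp(6x^τ + 3x^τ log x + x log M₁ + x log M₂ − x^ν)`. [folklore] -/
theorem step1_value_factor_le (hE : 2 ≤ E) :
    (2 * E + 1 : ℝ) ^ (3 * S.T E) * (max 1 ‖S.ξ‖ ^ E * max 1 ‖S.η‖⁻¹ ^ E) * Real.exp (-(E : ℝ) ^ S.ν) ≤
      Real.exp (6 * (E : ℝ) ^ S.τ + 3 * (E : ℝ) ^ S.τ * Real.log E +
        E * Real.log (max 1 ‖S.ξ‖) + E * Real.log (max 1 ‖S.η‖⁻¹) - (E : ℝ) ^ S.ν) := by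
  obtain ⟨hx2, hx0, hlog, hT1, hTle, hxτ, -⟩ := S.basics hE
  have hM1 : (1 : ℝ) ≤ max 1 ‖S.ξ‖ := le_max_left _ _
  have hM2 : (1 : ℝ) ≤ max 1 ‖S.η‖⁻¹ := le_max_left _ _
  have h1 : (2 * E + 1 : ℝ) ^ (3 * S.T E) ≤ Real.exp (6 * (E : ℝ) ^ S.τ + 3 * (E : ℝ) ^ S.τ * Real.log E) := by
    have hpos : (0 : ℝ) < 2 * E + 1 := by linarith
    rw [show (2 * E + 1 : ℝ) ^ (3 * S.T E) = Real.exp ((3 * S.T E : ℕ) * Real.log (2 * E + 1)) by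
      rw [Real.exp_nat_mul, Real.exp_log hpos]]
    refine Real.exp_le_exp.mpr ?_
    have hl : Real.log (2 * E + 1) ≤ 2 + Real.log E := by
      calc Real.log (2 * E + 1) ≤ Real.log (3 * E) := Real.log_le_log hpos (by linarith)
        _ = Real.log 3 + Real.log E := Real.log_mul (by norm_num) hx0.ne'
        _ ≤ 2 + Real.log E := by linarith [Real.log_le_sub_one_of_pos (by norm_num : (0:ℝ) < 3)]
    push_cast
    have : (3 : ℝ) * S.T E * Real.log (2 * E + 1) ≤ 3 * (E : ℝ) ^ S.τ * (2 + Real.log E) :=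
      mul_le_mul (by nlinarith) hl (Real.log_nonneg (by linarith)) (by positivity)
    nlinarith
  have h2 : max 1 ‖S.ξ‖ ^ E * max 1 ‖S.η‖⁻¹ ^ E =
      Real.exp (E * Real.log (max 1 ‖S.ξ‖) + E * Real.log (max 1 ‖S.η‖⁻¹)) := by
    rw [Real.exp_add, Real.exp_nat_mul, Real.exp_nat_mul, Real.exp_log (by linarith),
      Real.exp_log (by linarith)]
  rw [h2]
  calc (2 * E + 1 : ℝ) ^ (3 * S.T E) * Real.exp (E * Real.log (max 1 ‖S.ξ‖) + E * Real.log (max 1 ‖S.η‖⁻¹)) *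
        Real.exp (-(E : ℝ) ^ S.ν)
      ≤ Real.exp (6 * (E : ℝ) ^ S.τ + 3 * (E : ℝ) ^ S.τ * Real.log E) *
          Real.exp (E * Real.log (max 1 ‖S.ξ‖) + E * Real.log (max 1 ‖S.η‖⁻¹)) * Real.exp (-(E : ℝ) ^ S.ν) :=
        mul_le_mul_of_nonneg_right (mul_le_mul_of_nonneg_right h1 (Real.exp_pos _).le) (Real.exp_pos _).le
    _ = _ := by rw [← Real.exp_add, ← Real.exp_add]; ring_nf

/-- **`hA2`** from `6x^τ + 3x^τ log x + x log M₁ + x log M₂ ≤ x^ν/2`. [cite: Roy2013, §7, Step 1] -/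
theorem hA2_of (hE : 2 ≤ E)
    (h : 6 * (E : ℝ) ^ S.τ + 3 * (E : ℝ) ^ S.τ * Real.log E + E * Real.log (max 1 ‖S.ξ‖) +
      E * Real.log (max 1 ‖S.η‖⁻¹) ≤ (E : ℝ) ^ S.ν / 2) :
    (2 * E + 1 : ℝ) ^ (3 * S.T E) * (max 1 ‖S.ξ‖ ^ E * max 1 ‖S.η‖⁻¹ ^ E) * Real.exp (-(E : ℝ) ^ S.ν) ≤
      Real.exp (-S.U E) := by
  refine (S.step1_value_factor_le hE).trans (Real.exp_le_exp.mpr ?_)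
  rw [Setting.U]; linarith

/-- **`hA4`** from `log x + 2x log x + 6x^τ + 3x^τ log x + x log M₁ + x log M₂ ≤ x^ν/2`.
[cite: Roy2013, §7, Step 2] -/
theorem hA4_of (hE : 2 ≤ E)
    (h : Real.log E + 2 * E * Real.log E + 6 * (E : ℝ) ^ S.τ + 3 * (E : ℝ) ^ S.τ * Real.log E +
      E * Real.log (max 1 ‖S.ξ‖) + E * Real.log (max 1 ‖S.η‖⁻¹) ≤ (E : ℝ) ^ S.ν / 2) :
    (E : ℝ) * ((E : ℝ) ^ 2) ^ E * ((2 * E + 1 : ℝ) ^ (3 * S.T E) *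
      (max 1 ‖S.ξ‖ ^ E * max 1 ‖S.η‖⁻¹ ^ E) * Real.exp (-(E : ℝ) ^ S.ν)) ≤ Real.exp (-S.U E) := by
  obtain ⟨hx2, hx0, hlog, -, -, -, -⟩ := S.basics hE
  have h1 : (E : ℝ) * ((E : ℝ) ^ 2) ^ E = Real.exp (Real.log E + 2 * E * Real.log E) := by
    rw [Real.exp_add, Real.exp_log hx0, show 2 * (E : ℝ) * Real.log E = ((2 * E : ℕ) : ℝ) * Real.log E by
      push_cast; ring, Real.exp_nat_mul, Real.exp_log hx0, pow_mul]
  rw [h1]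
  calc Real.exp (Real.log E + 2 * E * Real.log E) * ((2 * E + 1 : ℝ) ^ (3 * S.T E) *
        (max 1 ‖S.ξ‖ ^ E * max 1 ‖S.η‖⁻¹ ^ E) * Real.exp (-(E : ℝ) ^ S.ν))
      ≤ Real.exp (Real.log E + 2 * E * Real.log E) *
          Real.exp (6 * (E : ℝ) ^ S.τ + 3 * (E : ℝ) ^ S.τ * Real.log E +
            E * Real.log (max 1 ‖S.ξ‖) + E * Real.log (max 1 ‖S.η‖⁻¹) - (E : ℝ) ^ S.ν) :=
        mul_le_mul_of_nonneg_left (S.step1_value_factor_le hE) (Real.exp_pos _).le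
    _ ≤ Real.exp (-S.U E) := by
        rw [← Real.exp_add, Setting.U]; exact Real.exp_le_exp.mpr (by linarith)

/-- **`hYc`** from `3(L+1) ≤ E` and `x log c₇ + 9x^τ + 3x^τ log x ≤ 2x^β`.
[cite: Roy2013, Proposition 6.1 (the condition `2T log c₆ ≤ Y`)] -/
theorem hYc_of (hE : 2 ≤ E) (hL : 3 * (S.L E + 1) ≤ E)
    (h : E * Real.log (3 * (1 + ‖S.ξ‖ + ‖S.η‖⁻¹)) + 9 * (E : ℝ) ^ S.τ + 3 * (E : ℝ) ^ S.τ * Real.log E ≤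
      2 * (E : ℝ) ^ S.β) :
    (3 * (1 + ‖S.ξ‖ + ‖S.η‖⁻¹)) ^ S.L E * (4 * (S.L E + 1) : ℝ) ^ (S.L E + 2).choose 2 ≤ Real.exp (S.Y E) := by
  obtain ⟨hx2, hx0, hlog, hT1, hTle, hxτ, -⟩ := S.basics hE
  have hE1 : 1 ≤ E := le_trans one_le_two hE
  set c₇ : ℝ := 3 * (1 + ‖S.ξ‖ + ‖S.η‖⁻¹) with hc₇
  have hc₇3 : 3 ≤ c₇ := by
    have : (0 : ℝ) ≤ ‖S.ξ‖ := norm_nonneg _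
    have : (0 : ℝ) ≤ ‖S.η‖⁻¹ := inv_nonneg.mpr (norm_nonneg _)
    rw [hc₇]; linarith
  have hc₇0 : 0 < c₇ := by linarith
  have hlc₇ : 0 ≤ Real.log c₇ := Real.log_nonneg (by linarith)
  have hLx : (S.L E : ℝ) + 1 ≤ E := by
    have : ((3 * (S.L E + 1) : ℕ) : ℝ) ≤ E := by exact_mod_cast hL
    push_cast at this; linarith
  have hC : ((S.L E + 2).choose 2 : ℝ) ≤ 3 * (E : ℝ) ^ S.τ := by
    have := S.choose_L_le hE1
    have h' : (((S.L E + 2).choose 2 : ℕ) : ℝ) ≤ ((3 * S.T E : ℕ) : ℝ) := by exact_mod_cast this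
    push_cast at h'; linarith
  -- first factor
  have h1 : c₇ ^ S.L E ≤ Real.exp (E * Real.log c₇) := by
    rw [show c₇ ^ S.L E = Real.exp ((S.L E : ℕ) * Real.log c₇) by rw [Real.exp_nat_mul, Real.exp_log hc₇0]]
    exact Real.exp_le_exp.mpr (mul_le_mul_of_nonneg_right (by linarith) hlc₇)
  -- second factor
  have hL1 : (0 : ℝ) < 4 * (S.L E + 1) := by positivity
  have h2 : (4 * (S.L E + 1) : ℝ) ^ (S.L E + 2).choose 2 ≤
      Real.exp (3 * (E : ℝ) ^ S.τ * (3 + Real.log E)) := by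
    rw [show (4 * (S.L E + 1) : ℝ) ^ (S.L E + 2).choose 2 =
      Real.exp (((S.L E + 2).choose 2 : ℕ) * Real.log (4 * (S.L E + 1))) by
        rw [Real.exp_nat_mul, Real.exp_log hL1]]
    refine Real.exp_le_exp.mpr ?_
    have hl : Real.log (4 * (S.L E + 1)) ≤ 3 + Real.log E := by
      calc Real.log (4 * (S.L E + 1)) ≤ Real.log (4 * E) := Real.log_le_log hL1 (by linarith)
        _ = Real.log 4 + Real.log E := Real.log_mul (by norm_num) hx0.ne'
        _ ≤ 3 + Real.log E := by linarith [Real.log_le_sub_one_of_pos (by norm_num : (0:ℝ) < 4)]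
    exact mul_le_mul hC hl (Real.log_nonneg (by linarith)) (by positivity)
  calc c₇ ^ S.L E * (4 * (S.L E + 1) : ℝ) ^ (S.L E + 2).choose 2
      ≤ Real.exp (E * Real.log c₇) * Real.exp (3 * (E : ℝ) ^ S.τ * (3 + Real.log E)) :=
        mul_le_mul h1 h2 (by positivity) (Real.exp_pos _).le
    _ ≤ Real.exp (S.Y E) := by
        rw [← Real.exp_add, Setting.Y]; exact Real.exp_le_exp.mpr (by nlinarith)

/-- **`hε`** from `114x² + 32x² log x + 20x^{2+β} ≤ x^{τ+ν}/8`. [cite: Roy2013, §7, Step 2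
("`C'' = (C−5)/6 ≥ D^δ/25`")] -/
theorem hε_of (hE : 2 ≤ E)
    (h : 114 * (E : ℝ) ^ 2 + 32 * (E : ℝ) ^ 2 * Real.log E + 20 * (E : ℝ) ^ (2 + S.β) ≤
      (E : ℝ) ^ (S.τ + S.ν) / 8) :
    S.εlev E ≤ Real.exp (-(S.T E * S.U E) / 2) := by
  obtain ⟨hx2, hx0, hlog, hT1, hTle, hxτ, hTτ⟩ := S.basics hE
  have hE1 : 1 ≤ E := le_trans one_le_two hE
  obtain ⟨hk2, hk⟩ := kexp_bounds hE1
  have hN : ((Nrow E : ℕ) : ℝ) ≤ 10 * (E : ℝ) ^ 2 := choose_three_le hE1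
  have hN1 : (1 : ℝ) ≤ (Nrow E : ℕ) := by
    have : 1 ≤ Nrow E := Nat.choose_pos (by omega)
    exact_mod_cast this
  have hN0 : (0 : ℝ) < (Nrow E : ℕ) := by linarith
  -- `εlev ≤ exp(2k2^k log 2 − TU + N log N + N (log 3 + Y))`
  have h1 : (2 : ℝ) ^ (2 * kexp E * 2 ^ kexp E) = Real.exp ((2 * kexp E * 2 ^ kexp E : ℕ) * Real.log 2) := by
    rw [Real.exp_nat_mul, Real.exp_log two_pos]
  have h2 : ((Nrow E).factorial : ℝ) ≤ Real.exp ((Nrow E : ℕ) * Real.log (Nrow E : ℕ)) := by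
    have hf := log_factorial_le (Nrow E)
    calc ((Nrow E).factorial : ℝ) = Real.exp (Real.log ((Nrow E).factorial)) :=
          (Real.exp_log (by exact_mod_cast Nat.factorial_pos _)).symm
      _ ≤ Real.exp ((Nrow E : ℕ) * Real.log (Nrow E : ℕ)) := Real.exp_le_exp.mpr hf
  have h3 : (3 * Real.exp (S.Y E)) ^ Nrow E = Real.exp ((Nrow E : ℕ) * (Real.log 3 + S.Y E)) := by
    rw [Real.exp_nat_mul, Real.exp_add, Real.exp_log three_pos]
  have h4 : S.εlev E ≤ Real.exp ((2 * kexp E * 2 ^ kexp E : ℕ) * Real.log 2 + -(S.T E * S.U E) +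
      ((Nrow E : ℕ) * Real.log (Nrow E : ℕ) + (Nrow E : ℕ) * (Real.log 3 + S.Y E))) := by
    have hle : S.εlev E ≤ Real.exp ((2 * kexp E * 2 ^ kexp E : ℕ) * Real.log 2) *
        (Real.exp (-(S.T E * S.U E)) * (Real.exp ((Nrow E : ℕ) * Real.log (Nrow E : ℕ)) *
          Real.exp ((Nrow E : ℕ) * (Real.log 3 + S.Y E)))) := by
      rw [Setting.εlev, h1, h3]
      exact mul_le_mul_of_nonneg_left (mul_le_mul_of_nonneg_left
        (mul_le_mul_of_nonneg_right h2 (Real.exp_pos _).le) (Real.exp_pos _).le) (Real.exp_pos _).le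
    refine hle.trans (le_of_eq ?_)
    rw [Real.exp_add, Real.exp_add, Real.exp_add]; ring
  refine h4.trans (Real.exp_le_exp.mpr ?_)
  -- the exponent: bound each term
  have hl2 : Real.log 2 ≤ 1 := by linarith [Real.log_le_sub_one_of_pos two_pos]
  have hl3 : Real.log 3 ≤ 2 := by linarith [Real.log_le_sub_one_of_pos three_pos]
  have hkk : ((2 * kexp E * 2 ^ kexp E : ℕ) : ℝ) * Real.log 2 ≤ 4 * (E : ℝ) ^ 2 + 12 * (E : ℝ) ^ 2 * Real.log E := by
    push_cast
    have hk0 : (0 : ℝ) ≤ kexp E := Nat.cast_nonneg _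
    have hpos : (0 : ℝ) ≤ 2 * kexp E * 2 ^ kexp E := by positivity
    have h5 : (2 : ℝ) * kexp E * 2 ^ kexp E ≤ 2 * (1 + 3 * Real.log E) * (2 * (E : ℝ) ^ 2) :=
      mul_le_mul (by linarith) hk2 (by positivity) (by positivity)
    calc (2 : ℝ) * kexp E * 2 ^ kexp E * Real.log 2 ≤ 2 * kexp E * 2 ^ kexp E * 1 :=
          mul_le_mul_of_nonneg_left hl2 hpos
      _ ≤ 2 * (1 + 3 * Real.log E) * (2 * (E : ℝ) ^ 2) := by rw [mul_one]; exact h5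
      _ = 4 * (E : ℝ) ^ 2 + 12 * (E : ℝ) ^ 2 * Real.log E := by ring
  have hlogN : Real.log (Nrow E : ℕ) ≤ 9 + 2 * Real.log E := by
    calc Real.log (Nrow E : ℕ) ≤ Real.log (10 * (E : ℝ) ^ 2) := Real.log_le_log hN0 hN
      _ = Real.log 10 + 2 * Real.log E := by
          rw [Real.log_mul (by norm_num) (by positivity), Real.log_pow]; norm_num
      _ ≤ 9 + 2 * Real.log E := by linarith [Real.log_le_sub_one_of_pos (by norm_num : (0:ℝ) < 10)]
  have hNlogN : ((Nrow E : ℕ) : ℝ) * Real.log (Nrow E : ℕ) ≤ 90 * (E : ℝ) ^ 2 + 20 * (E : ℝ) ^ 2 * Real.log E := by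
    calc ((Nrow E : ℕ) : ℝ) * Real.log (Nrow E : ℕ) ≤ (10 * (E : ℝ) ^ 2) * (9 + 2 * Real.log E) :=
          mul_le_mul hN hlogN (Real.log_nonneg hN1) (by positivity)
      _ = _ := by ring
  have hNY : ((Nrow E : ℕ) : ℝ) * (Real.log 3 + S.Y E) ≤ 20 * (E : ℝ) ^ 2 + 20 * (E : ℝ) ^ (2 + S.β) := by
    rw [Setting.Y]
    have hβ : (0 : ℝ) ≤ (E : ℝ) ^ S.β := by positivity
    have h5 : (E : ℝ) ^ 2 * (E : ℝ) ^ S.β = (E : ℝ) ^ (2 + S.β) := by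
      rw [Real.rpow_add hx0, Real.rpow_two]
    calc ((Nrow E : ℕ) : ℝ) * (Real.log 3 + 2 * (E : ℝ) ^ S.β) ≤ (10 * (E : ℝ) ^ 2) * (2 + 2 * (E : ℝ) ^ S.β) :=
          mul_le_mul hN (by linarith) (by positivity) (by positivity)
      _ = 20 * (E : ℝ) ^ 2 + 20 * ((E : ℝ) ^ 2 * (E : ℝ) ^ S.β) := by ring
      _ = _ := by rw [h5]
  -- `TU ≥ x^{τ+ν}/4`
  have hTU : (E : ℝ) ^ (S.τ + S.ν) / 4 ≤ S.T E * S.U E := by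
    rw [Real.rpow_add hx0, Setting.U]
    have hν : (0 : ℝ) ≤ (E : ℝ) ^ S.ν := by positivity
    nlinarith
  linarith

/-- **`hfact`** from `90x² + 20x² log x ≤ 2x^{2+β}`. [folklore] -/
theorem hfact_of (hE : 2 ≤ E) (h : 90 * (E : ℝ) ^ 2 + 20 * (E : ℝ) ^ 2 * Real.log E ≤ 2 * (E : ℝ) ^ (2 + S.β)) :
    Real.log ((Nrow E).factorial) ≤ 2 * (E : ℝ) ^ (2 + S.β) := by
  obtain ⟨hx2, hx0, hlog, -, -, -, -⟩ := S.basics hE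
  have hE1 : 1 ≤ E := le_trans one_le_two hE
  have hN : ((Nrow E : ℕ) : ℝ) ≤ 10 * (E : ℝ) ^ 2 := choose_three_le hE1
  have hN1 : (1 : ℝ) ≤ (Nrow E : ℕ) := by
    have : 1 ≤ Nrow E := Nat.choose_pos (by omega)
    exact_mod_cast this
  have hlogN : Real.log (Nrow E : ℕ) ≤ 9 + 2 * Real.log E := by
    calc Real.log (Nrow E : ℕ) ≤ Real.log (10 * (E : ℝ) ^ 2) := Real.log_le_log (by linarith) hN
      _ = Real.log 10 + 2 * Real.log E := by
          rw [Real.log_mul (by norm_num) (by positivity), Real.log_pow]; norm_num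
      _ ≤ 9 + 2 * Real.log E := by linarith [Real.log_le_sub_one_of_pos (by norm_num : (0:ℝ) < 10)]
  refine (log_factorial_le _).trans ?_
  calc ((Nrow E : ℕ) : ℝ) * Real.log (Nrow E : ℕ) ≤ (10 * (E : ℝ) ^ 2) * (9 + 2 * Real.log E) :=
        mul_le_mul hN hlogN (Real.log_nonneg hN1) (by positivity)
    _ ≤ 2 * (E : ℝ) ^ (2 + S.β) := by nlinarith

/-- **`herr`** from the toolkit-shaped bound on `E₂`. [cite: Roy2013, §7, Step 2
("`+ 7T(log T)² deg(Z)`", absorbed since `β > τ`)] -/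
theorem herr_of (hE : 2 ≤ E)
    (h : (Real.log (1 + roy_c2 S.ξ S.η * Real.exp (1 + roy_c2 S.ξ S.η)) + 2 + Real.log (roy_c2 S.ξ S.η) +
        roy_c2 S.ξ S.η + 4) + 12 * Real.log E +
      ((1 + 2 * Real.log (2 * roy_c2 S.ξ S.η) + Real.log (2 * roy_c2 S.ξ S.η ^ 2)) +
        2 * (Real.log (3 * (1 + ‖S.ξ‖ + ‖S.η‖⁻¹) * max 1 (max ‖S.ξ‖ ‖S.η‖)) + 4)) * (E : ℝ) ^ S.τ +
      (12 + 6 * (Real.log (3 * (1 + ‖S.ξ‖ + ‖S.η‖⁻¹) * max 1 (max ‖S.ξ‖ ‖S.η‖)) + 4)) * (E : ℝ) ^ S.τ * Real.log E +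
      36 * (E : ℝ) ^ S.τ * Real.log E ^ 2 ≤ κ / 2 * (E : ℝ) ^ S.δ * (E : ℝ) ^ S.β) :
    errStep2 S.ξ S.η (S.T E) (S.k45 E) ≤ κ / 2 * (E : ℝ) ^ S.δ * (E : ℝ) ^ S.β := by
  obtain ⟨hx2, hx0, hlog, hT1, hTle, hxτ, -⟩ := S.basics hE
  have hE1 : 1 ≤ E := le_trans one_le_two hE
  have hT : 1 ≤ S.T E := le_trans hE1 (S.le_T E)
  have hk := S.k45_le hE1
  have hlT := S.log_T_le hE1
  have hc := one_le_roy_c2 S.ξ S.η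
  have hc8 := three_le_c8 S.ξ S.η
  set A : ℝ := Real.log (3 * (1 + ‖S.ξ‖ + ‖S.η‖⁻¹) * max 1 (max ‖S.ξ‖ ‖S.η‖)) + 4 with hA
  have hA0 : 4 ≤ A := by
    have := Real.log_nonneg (show (1:ℝ) ≤ 3 * (1 + ‖S.ξ‖ + ‖S.η‖⁻¹) * max 1 (max ‖S.ξ‖ ‖S.η‖) by linarith)
    rw [hA]; linarith
  set cB : ℝ := 1 + 2 * Real.log (2 * roy_c2 S.ξ S.η) + Real.log (2 * roy_c2 S.ξ S.η ^ 2) with hcB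
  have hcB0 : 0 ≤ cB := by
    have h1 : 0 ≤ Real.log (2 * roy_c2 S.ξ S.η) := Real.log_nonneg (by linarith)
    have h2 : 0 ≤ Real.log (2 * roy_c2 S.ξ S.η ^ 2) := Real.log_nonneg (by nlinarith)
    rw [hcB]; linarith
  have hbound := errStep2_le hT S.ξ S.η (S.k45 E)
  rw [← hA, ← hcB] at hbound
  refine hbound.trans (le_trans ?_ h)
  -- substitute `T ≤ x^τ`, `T log T ≤ 2 x^τ log x`, `k ≤ 1 + 3 log x`
  have hk0 : (0 : ℝ) ≤ S.k45 E := Nat.cast_nonneg _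
  have hTlogT : (S.T E : ℝ) * Real.log (S.T E) ≤ 2 * (E : ℝ) ^ S.τ * Real.log E := by
    calc (S.T E : ℝ) * Real.log (S.T E) ≤ (E : ℝ) ^ S.τ * (2 * Real.log E) :=
          mul_le_mul hTle hlT (Real.log_nonneg hT1) (by positivity)
      _ = _ := by ring
  have hinner : 2 + A * S.T E + 3 * S.T E * Real.log (S.T E) ≤ 2 + A * (E : ℝ) ^ S.τ + 6 * (E : ℝ) ^ S.τ * Real.log E := by
    nlinarith [mul_le_mul_of_nonneg_left hTle (by linarith : (0:ℝ) ≤ A)]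
  have hinner0 : 0 ≤ 2 + A * (E : ℝ) ^ S.τ + 6 * (E : ℝ) ^ S.τ * Real.log E := by positivity
  have h3 : 2 * (S.k45 E : ℝ) * (2 + A * S.T E + 3 * S.T E * Real.log (S.T E)) ≤
      2 * (1 + 3 * Real.log E) * (2 + A * (E : ℝ) ^ S.τ + 6 * (E : ℝ) ^ S.τ * Real.log E) := by
    calc 2 * (S.k45 E : ℝ) * (2 + A * S.T E + 3 * S.T E * Real.log (S.T E))
        ≤ 2 * (S.k45 E : ℝ) * (2 + A * (E : ℝ) ^ S.τ + 6 * (E : ℝ) ^ S.τ * Real.log E) :=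
          mul_le_mul_of_nonneg_left hinner (by positivity)
      _ ≤ 2 * (1 + 3 * Real.log E) * (2 + A * (E : ℝ) ^ S.τ + 6 * (E : ℝ) ^ S.τ * Real.log E) :=
          mul_le_mul_of_nonneg_right (by linarith) hinner0
  have h4 : cB * (S.T E : ℝ) ≤ cB * (E : ℝ) ^ S.τ := mul_le_mul_of_nonneg_left hTle hcB0
  nlinarith [mul_nonneg (mul_nonneg (by positivity : (0:ℝ) ≤ (E : ℝ) ^ S.τ) hlog) hlog]

/-- **`hE₄`** from `log 4 + x log c₄ ≤ x^β`. [cite: Roy2013, §7, Step 4 ("`≤ 4(D*)^β`")] -/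
theorem hE₄_of (h : Real.log 4 + E * Real.log (roy_c4 S.ξ S.η) ≤ (E : ℝ) ^ S.β) :
    Real.log 4 + S.Y E + E * Real.log (roy_c4 S.ξ S.η) ≤ 3 * (E : ℝ) ^ S.β := by
  rw [Setting.Y]; linarith

end pointwise

/-! ### `Good E` for all large `E` -/

set_option maxHeartbeats 1600000 in
/-- **The side conditions hold for `E ≫ 0`.** [cite: Roy2013, §7 ("assuming that `D` is
sufficiently large")] -/
theorem eventually_good : ∀ᶠ E : ℕ in atTop, S.Good E := by
  have hβ1 := S.one_lt_β
  have hτ1 := S.hτ1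
  have hτ2 := S.hτ2
  have hτβ := S.hτβ
  have hν2 := S.two_lt_ν
  have hδ := S.δ_pos
  have hν := S.hν
  have hδβ : S.τ < S.δ + S.β := by rw [Setting.δ]; linarith
  have hδβ0 : 0 < S.δ + S.β := by linarith
  have h2ν : (2 : ℝ) < S.τ + S.ν := by linarith
  have hβν : 2 + S.β < S.τ + S.ν := by have := S.δ_pos; rw [Setting.δ] at this; linarith
  have hst : 2 + S.β - S.τ < S.ν := by
    have h1 : 0 ≤ (S.τ - 1) * (2 - S.τ) / (S.β + 1 - S.τ) := by
      have : 0 ≤ S.τ - 1 := by linarith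
      have : 0 ≤ 2 - S.τ := by linarith [S.hτ2]
      have : 0 < S.β + 1 - S.τ := by linarith
      positivity
    linarith
  have hν0 : (0 : ℝ) < S.ν := by linarith
  have hτν : S.τ < S.ν := by linarith
  have hβ0 : (0 : ℝ) < S.β := by linarith
  have h22 : (2 : ℝ) < 2 + S.β := by linarith
  -- thresholds
  have e0 : ∀ᶠ E : ℕ in atTop, S.D₁ ≤ E := eventually_ge_atTop _
  have e1 : ∀ᶠ E : ℕ in atTop, 12 ≤ E := eventually_ge_atTop _
  -- hA1
  have t1 := eventually_nat_mul_rpow_mul_log_pow_le' S.τ S.β 2 1 (c := 1 / 2) (by norm_num) hτβ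
  have t2 := eventually_nat_mul_rpow_mul_log_pow_le' 1 S.β 2 0 (c := 1 / 2) (by norm_num) hβ1
  -- hA3 (with t1, t2)
  have t3 := eventually_nat_mul_rpow_mul_log_pow_le' 0 S.β 1 1 (c := 1 / 4) (by norm_num) hβ0
  have t4 := eventually_nat_mul_rpow_mul_log_pow_le' 1 S.β 2 1 (c := 1 / 4) (by norm_num) hβ1
  have t5 := eventually_nat_mul_rpow_mul_log_pow_le' S.τ S.β 2 1 (c := 1 / 4) (by norm_num) hτβ
  have t6 := eventually_nat_mul_rpow_mul_log_pow_le' 1 S.β 2 0 (c := 1 / 4) (by norm_num) hβ1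
  -- hA2 / hA4
  have t7 := eventually_nat_mul_rpow_mul_log_pow_le' S.τ S.ν 6 0 (c := 1 / 12) (by norm_num) hτν
  have t8 := eventually_nat_mul_rpow_mul_log_pow_le' S.τ S.ν 3 1 (c := 1 / 12) (by norm_num) hτν
  have t9 := eventually_nat_mul_rpow_mul_log_pow_le' 1 S.ν (Real.log (max 1 ‖S.ξ‖)) 0 (c := 1 / 12)
    (by norm_num) (by linarith)
  have t10 := eventually_nat_mul_rpow_mul_log_pow_le' 1 S.ν (Real.log (max 1 ‖S.η‖⁻¹)) 0 (c := 1 / 12)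
    (by norm_num) (by linarith)
  have t11 := eventually_nat_mul_rpow_mul_log_pow_le' 0 S.ν 1 1 (c := 1 / 12) (by norm_num) hν0
  have t12 := eventually_nat_mul_rpow_mul_log_pow_le' 1 S.ν 2 1 (c := 1 / 12) (by norm_num) (by linarith)
  -- hL
  have t13 := eventually_nat_mul_rpow_mul_log_pow_le' S.τ 2 36 0 (c := 1) one_pos S.hτ2
  -- hYc
  have t14 := eventually_nat_mul_rpow_mul_log_pow_le' 1 S.β (Real.log (3 * (1 + ‖S.ξ‖ + ‖S.η‖⁻¹))) 0
    (c := 2 / 3) (by norm_num) hβ1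
  have t15 := eventually_nat_mul_rpow_mul_log_pow_le' S.τ S.β 9 0 (c := 2 / 3) (by norm_num) hτβ
  have t16 := eventually_nat_mul_rpow_mul_log_pow_le' S.τ S.β 3 1 (c := 2 / 3) (by norm_num) hτβ
  -- hε
  have t17 := eventually_nat_mul_rpow_mul_log_pow_le' 2 (S.τ + S.ν) 114 0 (c := 1 / 24) (by norm_num) h2ν
  have t18 := eventually_nat_mul_rpow_mul_log_pow_le' 2 (S.τ + S.ν) 32 1 (c := 1 / 24) (by norm_num) h2ν
  have t19 := eventually_nat_mul_rpow_mul_log_pow_le' (2 + S.β) (S.τ + S.ν) 20 0 (c := 1 / 24)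
    (by norm_num) hβν
  -- hfact
  have t20 := eventually_nat_mul_rpow_mul_log_pow_le' 2 (2 + S.β) 90 0 (c := 1) one_pos h22
  have t21 := eventually_nat_mul_rpow_mul_log_pow_le' 2 (2 + S.β) 20 1 (c := 1) one_pos h22
  -- herr
  have t22 := eventually_nat_mul_rpow_mul_log_pow_le' 0 (S.δ + S.β)
    (Real.log (1 + roy_c2 S.ξ S.η * Real.exp (1 + roy_c2 S.ξ S.η)) + 2 + Real.log (roy_c2 S.ξ S.η) +
      roy_c2 S.ξ S.η + 4) 0 (c := 1 / 1920) (by norm_num) hδβ0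
  have t23 := eventually_nat_mul_rpow_mul_log_pow_le' 0 (S.δ + S.β) 12 1 (c := 1 / 1920) (by norm_num) hδβ0
  have t24 := eventually_nat_mul_rpow_mul_log_pow_le' S.τ (S.δ + S.β)
    ((1 + 2 * Real.log (2 * roy_c2 S.ξ S.η) + Real.log (2 * roy_c2 S.ξ S.η ^ 2)) +
      2 * (Real.log (3 * (1 + ‖S.ξ‖ + ‖S.η‖⁻¹) * max 1 (max ‖S.ξ‖ ‖S.η‖)) + 4)) 0
    (c := 1 / 1920) (by norm_num) hδβ
  have t25 := eventually_nat_mul_rpow_mul_log_pow_le' S.τ (S.δ + S.β)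
    (12 + 6 * (Real.log (3 * (1 + ‖S.ξ‖ + ‖S.η‖⁻¹) * max 1 (max ‖S.ξ‖ ‖S.η‖)) + 4)) 1
    (c := 1 / 1920) (by norm_num) hδβ
  have t26 := eventually_nat_mul_rpow_mul_log_pow_le' S.τ (S.δ + S.β) 36 2 (c := 1 / 1920) (by norm_num) hδβ
  -- hstep4
  have t27 := eventually_nat_mul_rpow_mul_log_pow_le' 0 S.ν (Real.log 2 + 2 * roy_c2 S.ξ S.η ^ 2) 0
    (c := 1 / 4) (by norm_num) hν0
  have t28 := eventually_nat_mul_rpow_mul_log_pow_le' (2 + S.β - S.τ) S.ν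
    (44 * (2 : ℝ) ^ (1 + S.β - S.τ) + 16) 0 (c := 1 / 4) (by norm_num) hst
  -- hE₄
  have t29 := eventually_nat_mul_rpow_mul_log_pow_le' 0 S.β (Real.log 4) 0 (c := 1 / 2) (by norm_num) hβ0
  have t30 := eventually_nat_mul_rpow_mul_log_pow_le' 1 S.β (Real.log (roy_c4 S.ξ S.η)) 0 (c := 1 / 2)
    (by norm_num) hβ1
  filter_upwards [e0, e1, t1, t2, t3, t4, t5, t6, t7, t8, t9, t10, t11, t12, t13, t14, t15, t16, t17, t18, t19,
    t20, t21, t22, t23, t24, t25, t26, t27, t28, t29, t30] with E h0 h12 u1 u2 u3 u4 u5 u6 u7 u8 u9 u10 u11 u12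
    u13 u14 u15 u16 u17 u18 u19 u20 u21 u22 u23 u24 u25 u26 u27 u28 u29 u30
  simp only [Real.rpow_zero, Real.rpow_one, Real.rpow_two, pow_zero, pow_one, mul_one, one_mul] at *
  have hE2 : 2 ≤ E := by omega
  have hx0 : (0 : ℝ) < E := by exact_mod_cast lt_of_lt_of_le two_pos hE2
  obtain ⟨-, -, -, -, -, -, hTτ⟩ := S.basics hE2
  have hL := S.hL_of h12 u13
  have herr : errStep2 S.ξ S.η (S.T E) (S.k45 E) ≤ κ / 2 * (E : ℝ) ^ S.δ * (E : ℝ) ^ S.β := by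
    refine S.herr_of hE2 ?_
    have e : κ / 2 * (E : ℝ) ^ S.δ * (E : ℝ) ^ S.β = κ / 2 * (E : ℝ) ^ (S.δ + S.β) := by
      rw [Real.rpow_add hx0]; ring
    rw [e, Setting.κ]
    linarith
  rw [mul_comm] at u9 u10 u14 u30
  have hνpos : 0 ≤ (E : ℝ) ^ S.ν := by positivity
  have hβpos : 0 ≤ (E : ℝ) ^ S.β := by positivity
  refine ⟨h0, hE2, S.hA1_of hE2 (by linarith), S.hA2_of hE2 (by linarith), S.hA3_of hE2 (by linarith),
    S.hA4_of hE2 (by linarith), hL, S.hYc_of hE2 hL (by linarith), S.hε_of hE2 (by linarith),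
    S.hfact_of hE2 (by linarith), choose_two_le hE2, herr, hTτ, ?_, S.hE₄_of (by linarith)⟩
  rw [Setting.U]; linarith

/-! ### The separation threshold ("`D*` goes to infinity with `D`") -/

/-- A positive lower bound for `dist(α, (1:γ))` over all unit common zeros of `(P̃_E, Q_E)`.
[cite: Roy2013, §7, Step 3 ("`𝒵(𝒟ⁱP̃_{D*+1} ; 0 ≤ i ≤ D*+1)(ℂ)` is a finite subset of `ℙ²(ℚ̄)` and
so [...] does not contain the point `α₀`")] -/
theorem exists_sep_const (E : ℕ) (h1 : S.D₁ ≤ E) :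
    ∃ ε : ℝ, 0 < ε ∧ ∀ α : Fin 3 → ℂ, ‖α‖ = 1 → eval α (S.Pc E) = 0 →
      eval α (map (Int.castRingHom ℂ) (levelQ E (S.Ptil E) (S.pkg E h1).t)) = 0 → ε ≤ pdist S.ξ S.η α := by
  have h : S.D₀ ≤ E := le_trans (le_max_left _ _) h1
  have hPt := S.isHomogeneous_Pc h
  have hQc := isHomogeneous_map_levelQ hPt (S.pkg E h1).t
  obtain ⟨ε, hε, hεle⟩ := exists_pdist_lower_bound S.hnot (isHomogeneous_map_rat hPt) (isHomogeneous_map_rat hQc)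
    (by rw [toCX_map_int]; exact S.Pc_ne_zero h) (by rw [toCX_map_int]; exact (S.pkg E h1).hQ0)
    (by rw [toCX_map_int, toCX_map_int]; exact isRelPrime_of_regular (S.Pc_ne_zero h) (S.pkg E h1).hPQ)
  refine ⟨ε, hε, fun α hα hP hQ => hεle α hα ?_ ?_⟩
  · rw [toCX_map_int]; exact hP
  · rw [toCX_map_int]; exact hQ

/-- **The separation threshold**: for `D ≫_B 0`, the closeness `exp(−(κ/2)D^{δ+β}/T_D)` of
Step 2 beats the separation constants of all degrees `≤ B`. [cite: Roy2013, §7, Step 3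
("`D*` goes to infinity with `D`")] -/
theorem exists_sep_threshold (D₂ B : ℕ) :
    ∃ D₃ : ℕ, ∀ D, D₃ ≤ D → ∀ E (hE : S.D₁ ≤ E), D₂ ≤ E → E ≤ B → ∀ α : Fin 3 → ℂ, ‖α‖ = 1 →
      eval α (S.Pc E) = 0 → eval α (map (Int.castRingHom ℂ) (levelQ E (S.Ptil E) (S.pkg E hE).t)) = 0 →
      Real.exp (-(κ / 2 * (D : ℝ) ^ S.δ * (D : ℝ) ^ S.β) / S.T D) < pdist S.ξ S.η α := by
  classical
  -- the constants and their minimum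
  choose ε hε hεle using S.exists_sep_const
  let εE : ℕ → ℝ := fun E => if h : S.D₁ ≤ E then ε E h else 1
  have hεE : ∀ E, 0 < εE E := fun E => by
    show 0 < (if h : S.D₁ ≤ E then ε E h else 1)
    split_ifs with h
    · exact hε E h
    · exact one_pos
  set F : Finset ℝ := insert 1 ((Finset.Icc D₂ B).image εE) with hF
  have hFne : F.Nonempty := ⟨1, mem_insert_self _ _⟩
  set ε₀ : ℝ := F.min' hFne with hε₀
  have hε₀pos : 0 < ε₀ := by
    have hm := F.min'_mem hFne
    rw [← hε₀, hF, mem_insert, mem_image] at hm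
    rcases hm with h | ⟨E, -, h⟩
    · rw [h]; exact one_pos
    · rw [← h]; exact hεE E
  have hε₀le : ∀ E, D₂ ≤ E → E ≤ B → ε₀ ≤ εE E := fun E h1 h2 =>
    F.min'_le _ (by rw [hF, mem_insert, mem_image]; exact Or.inr ⟨E, mem_Icc.mpr ⟨h1, h2⟩, rfl⟩)
  -- closeness tends to `0`
  have hν2 : 0 < S.ν - 2 := by linarith [S.two_lt_ν]
  obtain ⟨D₃, hD₃⟩ := Filter.eventually_atTop.mp
    ((tendsto_natCast_atTop_atTop.eventually ((tendsto_rpow_atTop hν2).eventually_ge_atTop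
      ((2 / κ) * (|Real.log ε₀| + 1)))).and (eventually_ge_atTop 2))
  refine ⟨D₃, fun D hD E hE hE₁ hE₂ α hα hP hQ => ?_⟩
  obtain ⟨hbig, hD2⟩ := hD₃ D hD
  obtain ⟨hx2, hx0, hlog, hT1, hTle, hxτ, -⟩ := S.basics hD2
  have hκ : (0 : ℝ) < κ := by rw [Setting.κ]; norm_num
  -- `exp(−X/T) ≤ exp(−(κ/2) D^{ν−2})`
  have h1 : Real.exp (-(κ / 2 * (D : ℝ) ^ S.δ * (D : ℝ) ^ S.β) / S.T D) ≤
      Real.exp (-(κ / 2 * (D : ℝ) ^ (S.ν - 2))) := by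
    refine Real.exp_le_exp.mpr ?_
    rw [neg_div, neg_le_neg_iff, le_div_iff₀ (by linarith)]
    have h2 : (D : ℝ) ^ S.δ * (D : ℝ) ^ S.β = (D : ℝ) ^ (S.ν - 2) * (D : ℝ) ^ S.τ := by
      rw [← Real.rpow_add hx0, ← Real.rpow_add hx0]; congr 1; rw [Setting.δ]; ring
    have h3 : 0 ≤ κ / 2 * (D : ℝ) ^ (S.ν - 2) := by positivity
    calc κ / 2 * (D : ℝ) ^ (S.ν - 2) * S.T D ≤ κ / 2 * (D : ℝ) ^ (S.ν - 2) * (D : ℝ) ^ S.τ :=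
          mul_le_mul_of_nonneg_left hTle h3
      _ = κ / 2 * (D : ℝ) ^ S.δ * (D : ℝ) ^ S.β := by rw [mul_assoc, ← h2]; ring
  -- `exp(−(κ/2) D^{ν−2}) < ε₀`
  have h4 : Real.exp (-(κ / 2 * (D : ℝ) ^ (S.ν - 2))) < ε₀ := by
    rw [← Real.exp_log hε₀pos]
    refine Real.exp_lt_exp.mpr ?_
    have h5 : |Real.log ε₀| + 1 ≤ κ / 2 * (D : ℝ) ^ (S.ν - 2) := by
      have := mul_le_mul_of_nonneg_left hbig (show 0 ≤ κ / 2 by positivity)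
      calc |Real.log ε₀| + 1 = κ / 2 * (2 / κ * (|Real.log ε₀| + 1)) := by field_simp
        _ ≤ κ / 2 * (D : ℝ) ^ (S.ν - 2) := this
    have h6 := neg_abs_le (Real.log ε₀)
    linarith
  -- the constant of the degree `E`
  have h7 : ε₀ ≤ pdist S.ξ S.η α := by
    refine (hε₀le E hE₁ hE₂).trans ?_
    have : εE E = ε E hE := by show (if h : S.D₁ ≤ E then ε E h else 1) = _; rw [dif_pos hE]
    rw [this]
    exact hεle E hE α hα hP hQ
  linarith

/-! ### The contradiction -/

/-- **The setting is contradictory** (so, vacuously, `ξ` and `η` are algebraic): Theorem 1.1 of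
Roy 2013. [cite: Roy2013, Theorem 1.1 and §7, Step 5 ("This contradicts the hypothesis on `ν` [...]
and therefore proves that `ξ, η ∈ ℚ̄`")] -/
theorem isAlgebraic : IsAlgebraic ℚ S.ξ ∧ IsAlgebraic ℚ S.η := by
  refine False.elim ?_
  obtain ⟨D₂, hD₂⟩ := Filter.eventually_atTop.mp S.eventually_good
  have hκ : (0 : ℝ) < κ / 2 := by rw [Setting.κ]; norm_num
  refine endgame S.hτ1 S.hτβ S.δ_pos S.δ_lower (κ := κ / 2) (A := 5) (A₃ := 44 * (2 : ℝ) ^ (1 + S.β - S.τ))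
    hκ (by norm_num) (by positivity) fun N => ?_
  obtain ⟨N₁, hN₁⟩ := exists_nat_ge N
  obtain ⟨D₃, hD₃⟩ := S.exists_sep_threshold D₂ (max N₁ D₂ + 1)
  have hG : S.Good (max (max D₃ (max N₁ D₂ + 1)) D₂) := hD₂ _ (le_max_right _ _)
  obtain ⟨Ds, d, hZ, T, Ts, h⟩ := S.main_step hG (D₂ := D₂) (fun E h1 _ => hD₂ E h1)
    (B := max N₁ D₂ + 1) (by omega) (by omega) (hD₃ _ (by omega))
  refine ⟨(max (max D₃ (max N₁ D₂ + 1)) D₂ : ℕ), ?_, Ds, d, hZ, T, Ts, h⟩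
  have : (N₁ : ℝ) ≤ ((max (max D₃ (max N₁ D₂ + 1)) D₂ : ℕ) : ℝ) := by exact_mod_cast (by omega)
  linarith

end Setting

end Roy2013

open Roy2013 in
/-- **Roy 2013, Theorem 1.1** (small value estimate for `𝔾ₐ × 𝔾ₘ`) from this chain: the named fact
`roy2013_thm_1_1` follows from `Setting.isAlgebraic`. (The tree's discharge of the fact is
`roy2013_thm_1_1_holds` in `RoySmallValueMain.lean`; this `example` records that the assembly
`RoySmallValueMainA`–`MainE` closes as well.) [cite: Roy2013, Theorem 1.1] -/
example : roy2013_thm_1_1 := by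
  intro ξ η hη β τ ν hτ1 hτ2 hτβ hν H
  by_contra hnot
  obtain ⟨D₀, hD₀⟩ := Filter.eventually_atTop.mp H
  choose P hP using hD₀
  classical
  exact hnot (Setting.isAlgebraic
    { ξ := ξ, η := η, β := β, τ := τ, ν := ν, D₀ := D₀,
      P := fun D => if h : D₀ ≤ D then P D h else 0,
      hη := hη, hτ1 := hτ1, hτ2 := hτ2, hτβ := hτβ, hν := hν,
      hP := fun D hD => by simp only [dif_pos hD]; exact hP D hD,
      hnot := hnot })

end Literature.NumberTheory.Transcendental
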